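import Mathlib
import Summits.NavierStokesRegularity.NavierStokesRegularity.Theorems.ThreadingFluxHorizonTowerQuadraticGeneratorMixed
import Summits.NavierStokesRegularity.NavierStokesRegularity.Theorems.ThreadingFluxHorizonTowerQuadraticGeneratorCone
import Summits.NavierStokesRegularity.NavierStokesRegularity.Theorems.ThreadingFluxHorizonTowerTwoFourSixDigits
import Summits.NavierStokesRegularity.NavierStokesRegularity.Theorems.ThreadingFluxHorizonTowerFiniteTowerThreeShell
import HarnessLib

/-!
# Crux `PoloidalLiouville` (stmt-NavierStokesRegularity-1222), crux idea «horizon-threading-tower» (ns-idea-15):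
# FINITE TOWERS AT ORDER ONE — THM I: THE TOWER `{2, 4, 6, 8}` (gcd-2 top pair, a competitor AND a second free shell)

Support file (`--supports stmt-NavierStokesRegularity-1222`, helper; cell `ns-wall-extremal`, width hand ns-wall-eng-3 g5; 0 kit).

★★ THM I `finiteTower_zonal_of_twoFourSixEight`: a scale-free tower `U_{H₂} + U_{H₄} + U_{H₆} + U_{H₈}` of horizon profiles of
smooth homogeneous harmonic shells of degrees `2, 4, 6, 8` (`H₂`, `H₄` possibly zero) with `H₆, H₈ ≢ 0`, annihilated by the order-one
horizon law off the centre, is COAXIALLY ZONAL — the smallest tower not decided by THM A–H, C′, C″ (two FREE lower shells under a gcd-2 top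
pair).  PROOF: digits 0–2 = THM G verbatim (the top pair `(6,8)` makes `P₆ = c₁B`, `P₈ = c₂C` over ONE real quadratic generator `L = xᵀQx`;
the class identity `15{P₆,P₈} + 26ρ{P₄,P₈} + 11ρ²{P₄,P₆} + 33ρ²{P₂,P₈} + 18ρ³{P₂,P₆} + 7ρ⁴{P₂,P₄} = 0` read mod `ρ²` does not see `P₂`
and confines `65P₄ = κA − 9c₁A′` to the plane `⟨π₄(L²), π₄(L·|Qx|²)⟩`); at digit 3 the closed form on the span (`classIdentity468_span`)
plus the one new term `33·65·c₂{P₂,C}|₀ = 2145·8580c₂·L³{P₂,L}` give, on the null cone,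
`L²·[−285405120c₁c₂·W·M + L·(k_L W + 18404100c₂{P₂,L})] = 0`, i.e. `chartT L ∣ 285405120c₁c₂ · chartT W · chartT M`; by the
COPRIMALITY OF THE GENERATOR CHARTS off the uniaxial locus (`Zonal.eq_zero_of_chartT_genL_dvd`, `…QuadraticGeneratorCone`) this forces
`c₁c₂ = 0` unless `W ≡ 0`, and `W ≡ 0` gives `{L, M₀} = 0`, same-degree rigidity, `Q² = βQ + γI`, the uniaxial lemma and THM A.

HONEST LABEL: ONE more cell of the crux-idea CONJECTURE `HorizonTowerZonality` at ORDER ONE (information-grade); the general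
«gcd-2 top pair with a competitor» family, gcd ≥ 3, ties, general towers, `PoloidalLiouville` (1222), `UnthreadedRigidity` (27585) OPEN;
W1 movement 0; NS regularity NOT proved.  [folklore]
-/

-- the summit and its single sub-problem share the name (CONVENTIONS §1)
set_option linter.dupNamespace false

noncomputable section

open MvPolynomial Complex
open scoped Polynomial RealInnerProductSpace
open Literature.Analysis.FluidPDE (cross)

namespace Summit.NavierStokesRegularity.NavierStokesRegularity.Theorems.PoloidalLiouville.HorizonTower

/-! ### The class identity of `{2, 4, 6, 8}` -/

/-- The order-one class polynomial identity of the tower `{2,4,6,8}` (one parity class, top level `N = 14`):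
`15{P₆,P₈} + 26ρ{P₄,P₈} + 11ρ²{P₄,P₆} + 33ρ²{P₂,P₈} + 18ρ³{P₂,P₆} + 7ρ⁴{P₂,P₄} = 0`. [folklore] -/
theorem finiteTower_classIdentity_twoFourSixEight (H : ℕ → E3 → ℝ)
    (hH : ∀ l ∈ ({2, 4, 6, 8} : Finset ℕ), ContDiff ℝ (⊤ : ℕ∞) (H l))
    (hhom : ∀ l ∈ ({2, 4, 6, 8} : Finset ℕ), ∀ (c : ℝ) (y : E3), H l (c • y) = c ^ l * H l y)
    (hharm : ∀ l ∈ ({2, 4, 6, 8} : Finset ℕ), ∀ y, Laplacian.laplacian (H l) y = 0)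
    (hL1 : ∀ x : E3, x ≠ 0 → horizonL1 (fun z => ∑ l ∈ ({2, 4, 6, 8} : Finset ℕ), horizonProfile l (H l) 0 z) 0 x = 0)
    (P : ℕ → MvPolynomial (Fin 3) ℝ) (hP : ∀ l ∈ ({2, 4, 6, 8} : Finset ℕ), ∀ y, H l y = Zonal.evalE (P l) y) :
    C 15 * Zonal.detP (P 6) (P 8) + C 26 * Zonal.normSq * Zonal.detP (P 4) (P 8)
      + C 11 * Zonal.normSq ^ 2 * Zonal.detP (P 4) (P 6)
      + (C 33 * Zonal.normSq ^ 2 * Zonal.detP (P 2) (P 8) + C 18 * Zonal.normSq ^ 3 * Zonal.detP (P 2) (P 6)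
        + C 7 * Zonal.normSq ^ 4 * Zonal.detP (P 2) (P 4)) = 0 := by
  classical
  have hK : ∀ l ∈ ({2, 4, 6, 8} : Finset ℕ), 1 ≤ l := by
    intro l hl
    simp only [Finset.mem_insert, Finset.mem_singleton] at hl
    omega
  have h := finiteTower_classPoly_eq_zero {2, 4, 6, 8} H hK hH hhom hharm hL1 P hP 14 (by
    intro j hj k hk hjk
    simp only [Finset.mem_insert, Finset.mem_singleton] at hj hk
    rcases hj with rfl | rfl | rfl | rfl <;> rcases hk with rfl | rfl | rfl | rfl <;> first | omega | exact Zonal.detP_self' _)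
  have h2 : (2 : ℕ) ∉ ({4, 6, 8} : Finset ℕ) := by decide
  have h4 : (4 : ℕ) ∉ ({6, 8} : Finset ℕ) := by decide
  have h6 : (6 : ℕ) ∉ ({8} : Finset ℕ) := by decide
  simp only [Finset.sum_insert h2, Finset.sum_insert h4, Finset.sum_insert h6, Finset.sum_singleton] at h
  norm_num at h
  rw [Zonal.detP_antisymm (P 2) (P 4), Zonal.detP_antisymm (P 2) (P 6), Zonal.detP_antisymm (P 2) (P 8),
    Zonal.detP_antisymm (P 4) (P 6), Zonal.detP_antisymm (P 4) (P 8), Zonal.detP_antisymm (P 6) (P 8)] at h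
  have h4' : (C (-4 : ℝ) : MvPolynomial (Fin 3) ℝ) ≠ 0 := by rw [Ne, C_eq_zero]; norm_num
  have key : C (-4 : ℝ) * (C 15 * Zonal.detP (P 6) (P 8) + C 26 * Zonal.normSq * Zonal.detP (P 4) (P 8)
      + C 11 * Zonal.normSq ^ 2 * Zonal.detP (P 4) (P 6)
      + (C 33 * Zonal.normSq ^ 2 * Zonal.detP (P 2) (P 8) + C 18 * Zonal.normSq ^ 3 * Zonal.detP (P 2) (P 6)
        + C 7 * Zonal.normSq ^ 4 * Zonal.detP (P 2) (P 4))) = 0 := by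
    rw [← h, Zonal.normSq]
    simp only [map_neg, map_ofNat]
    ring
  exact (mul_eq_zero.mp key).resolve_left h4'

/-! ### THM I, polynomial level -/

/-- ★★ **THM I, polynomial level.**  In the tower `{2,4,6,8}` passing order one with `P₆, P₈ ≠ 0`, the top shell is annihilated by
the rotation derivative about a real axis. [folklore] -/
theorem finiteTower_exists_axis_of_twoFourSixEight (H : ℕ → E3 → ℝ)
    (hH : ∀ l ∈ ({2, 4, 6, 8} : Finset ℕ), ContDiff ℝ (⊤ : ℕ∞) (H l))
    (hhom : ∀ l ∈ ({2, 4, 6, 8} : Finset ℕ), ∀ (c : ℝ) (y : E3), H l (c • y) = c ^ l * H l y)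
    (hharm : ∀ l ∈ ({2, 4, 6, 8} : Finset ℕ), ∀ y, Laplacian.laplacian (H l) y = 0)
    (hL1 : ∀ x : E3, x ≠ 0 → horizonL1 (fun z => ∑ l ∈ ({2, 4, 6, 8} : Finset ℕ), horizonProfile l (H l) 0 z) 0 x = 0)
    (P : ℕ → MvPolynomial (Fin 3) ℝ)
    (hP : ∀ l ∈ ({2, 4, 6, 8} : Finset ℕ), (P l).IsHomogeneous l ∧ Zonal.lapP (P l) = 0 ∧ ∀ y, H l y = Zonal.evalE (P l) y)
    (hP6 : P 6 ≠ 0) (hP8 : P 8 ≠ 0) :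
    ∃ n : Fin 3 → ℝ, n ≠ 0 ∧ Zonal.detP (C (n 0) * X 0 + C (n 1) * X 1 + C (n 2) * X 2) (P 8) = 0 := by
  classical
  have hK : ∀ l ∈ ({2, 4, 6, 8} : Finset ℕ), 1 ≤ l := by
    intro l hl; simp only [Finset.mem_insert, Finset.mem_singleton] at hl; omega
  have h4K : (4 : ℕ) ∈ ({2, 4, 6, 8} : Finset ℕ) := by simp
  have h6K : (6 : ℕ) ∈ ({2, 4, 6, 8} : Finset ℕ) := by simp
  have h8K : (8 : ℕ) ∈ ({2, 4, 6, 8} : Finset ℕ) := by simp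
  have hρ0 : (Zonal.normSq : Zonal.RPoly) ≠ 0 := Zonal.rho_ne_zero
  -- the class identity
  have hE := finiteTower_classIdentity_twoFourSixEight H hH hhom hharm hL1 P (fun l hl => (hP l hl).2.2)
  -- the top pair `(6, 8)`: as in THM F
  set f : ℂ[X] := Zonal.chartT (map (algebraMap ℝ ℂ) (P 6)) with hf
  set g : ℂ[X] := Zonal.chartT (map (algebraMap ℝ ℂ) (P 8)) with hg
  have hW := finiteTower_top_wronskian {2, 4, 6, 8} H hK hH hhom hharm hL1 P (fun l hl => ⟨(hP l hl).1, (hP l hl).2.2⟩) h8K h6K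
    (by norm_num) (by intro l hl; simp only [Finset.mem_insert, Finset.mem_singleton] at hl; omega)
    (by intro l hl hl8; simp only [Finset.mem_insert, Finset.mem_singleton] at hl; omega)
  have hW' : (3 : ℂ[X]) * f * Polynomial.derivative g = (4 : ℂ[X]) * g * Polynomial.derivative f := by
    have h2 : (2 : ℂ[X]) * ((3 : ℂ[X]) * f * Polynomial.derivative g - (4 : ℂ[X]) * g * Polynomial.derivative f) = 0 := by
      rw [← hf, ← hg] at hW
      linear_combination hW
    exact sub_eq_zero.mp ((mul_eq_zero.mp h2).resolve_left two_ne_zero)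
  have hWr := Zonal.wronskian_pow_pow_eq_zero (a := 3) (b := 4) (by norm_num) (by norm_num)
    (by exact_mod_cast hW')
  have hg0 : g ≠ 0 := fun h => hP8 (Zonal.eq_zero_of_chartT_map_eq_zero (hP 8 h8K).1 (hP 8 h8K).2.1 h)
  have hf0 : f ≠ 0 := fun h => hP6 (Zonal.eq_zero_of_chartT_map_eq_zero (hP 6 h6K).1 (hP 6 h6K).2.1 h)
  obtain ⟨c, hc⟩ := Zonal.exists_C_mul_of_wronskian_eq_zero (pow_ne_zero _ hg0) hWr
  set lc : ℂ := g.leadingCoeff with hlc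
  obtain ⟨q, hqm, hgq, hdeg⟩ := Zonal.exists_monic_eq_C_mul_pow_of_coprime (a := 4) (b := 3) (by decide) (by norm_num) hf0 hc
  rw [← hlc] at hgq
  have hq0 : q ≠ 0 := hqm.ne_zero
  have hq4 : q.natDegree ≤ 4 := by
    have h1 : g.natDegree ≤ 2 * 8 := Zonal.natDegree_chartT_le (((hP 8 h8K).1).map (algebraMap ℝ ℂ))
    omega
  have hf4 : f ^ 4 = Polynomial.C (c * lc ^ 3) * (q ^ 3) ^ 4 := by
    rw [hc, hgq, mul_pow, ← Polynomial.C_pow, ← mul_assoc, ← Polynomial.C_mul]; ring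
  obtain ⟨γ, hγ⟩ := Zonal.exists_eq_C_mul_pow_of_pow_eq (D := 4) (d := 3) (by norm_num) hq0 hf4
  obtain ⟨qa, qb, qd, qe, qf, hgen⟩ := Zonal.exists_gen_chartT_eq hq4
  rw [← hgen] at hγ hgq
  have hP6c : map (algebraMap ℝ ℂ) (P 6) = C (γ / 77) * Zonal.genB qa qb qd qe qf :=
    Zonal.eq_C_mul_genB_of_chartT_eq qa qb qd qe qf (((hP 6 h6K).1).map _)
      (by rw [← Zonal.map_lapP, (hP 6 h6K).2.1, map_zero]) hγ
  have hP8c : map (algebraMap ℝ ℂ) (P 8) = C (lc / 2145) * Zonal.genC qa qb qd qe qf :=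
    Zonal.eq_C_mul_genC_of_chartT_eq qa qb qd qe qf (((hP 8 h8K).1).map _)
      (by rw [← Zonal.map_lapP, (hP 8 h8K).2.1, map_zero]) hgq
  obtain ⟨w, ra, rb, rd, re, rf, hwa, hwb, hwd, hwe, hwf⟩ := Zonal.exists_real_gen_of_map_eq_C_mul_genB_genC hP6 hP8 hP6c hP8c
  rw [hwa, hwb, hwd, hwe, hwf] at hP6c hP8c hgen
  have hmapB : map (algebraMap ℝ ℂ) (Zonal.genB ra rb rd re rf) = Zonal.genB (ra : ℂ) rb rd re rf := by
    rw [Zonal.map_genB]; rfl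
  have hmapC : map (algebraMap ℝ ℂ) (Zonal.genC ra rb rd re rf) = Zonal.genC (ra : ℂ) rb rd re rf := by
    rw [Zonal.map_genC]; rfl
  have hmapL : map (algebraMap ℝ ℂ) (Zonal.genL ra rb rd re rf) = Zonal.genL (ra : ℂ) rb rd re rf := by
    rw [Zonal.map_genL]; rfl
  have hmapA : map (algebraMap ℝ ℂ) (Zonal.genA ra rb rd re rf) = Zonal.genA (ra : ℂ) rb rd re rf := by
    rw [Zonal.map_genA]; rfl
  rw [Zonal.genB_smul, ← mul_assoc, ← map_mul, ← hmapB] at hP6c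
  rw [Zonal.genC_smul, ← mul_assoc, ← map_mul, ← hmapC] at hP8c
  have hB0 : Zonal.genB ra rb rd re rf ≠ 0 := by
    intro h0
    rw [h0, map_zero, mul_zero, map_eq_zero_iff _ (map_injective (algebraMap ℝ ℂ) (RCLike.ofReal_injective))] at hP6c
    exact hP6 hP6c
  have hC0 : Zonal.genC ra rb rd re rf ≠ 0 := by
    intro h0
    rw [h0, map_zero, mul_zero, map_eq_zero_iff _ (map_injective (algebraMap ℝ ℂ) (RCLike.ofReal_injective))] at hP8c
    exact hP8 hP8c
  obtain ⟨c₁, hc₁⟩ := LoopLaw.exists_real_smul_of_map_eq_C_mul hB0 hP6c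
  obtain ⟨c₂, hc₂⟩ := LoopLaw.exists_real_smul_of_map_eq_C_mul hC0 hP8c
  rw [smul_eq_C_mul] at hc₁ hc₂
  have hc₁0 : c₁ ≠ 0 := by rintro rfl; exact hP6 (by rw [hc₁, C_0, zero_mul])
  have hc₂0 : c₂ ≠ 0 := by rintro rfl; exact hP8 (by rw [hc₂, C_0, zero_mul])
  have hL0 : Zonal.genL ra rb rd re rf ≠ 0 := by
    intro h0
    apply hq0
    rw [← hgen, Zonal.genL_smul, ← hmapL, h0, map_zero, mul_zero, Zonal.chartT_zero]
  have hLc0 : Zonal.genL (ra : ℂ) rb rd re rf ≠ 0 := by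
    intro h0; apply hL0
    exact map_injective (algebraMap ℝ ℂ) (RCLike.ofReal_injective) (by rw [hmapL, h0, map_zero])
  set L := Zonal.genL ra rb rd re rf with hLdef
  set M := Zonal.genM ra rb rd re rf with hMdef
  -- the harmonic companion `M₀` of `M` and the uniaxial exit
  set M₀ : Zonal.RPoly := M - C (Zonal.genTau ra rb rd re rf / 3) * Zonal.normSq with hM₀
  have hM₀h : M₀.IsHomogeneous 2 := (Zonal.isHomogeneous_genM ra rb rd re rf).sub (Zonal.isHomogeneous_normSq.C_mul _)
  have hM₀l : Zonal.lapP M₀ = 0 := by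
    rw [hM₀, Zonal.lapP_sub, Zonal.lapP_C_mul, Zonal.lapP_genM, Zonal.lapP_normSq, ← map_mul, ← map_sub,
      show 2 * Zonal.genTau ra rb rd re rf - Zonal.genTau ra rb rd re rf / 3 * 6 = 0 by ring, map_zero]
  have exit_of_span : ∀ β : ℝ, M₀ = C β * L →
      ∃ n : Fin 3 → ℝ, n ≠ 0 ∧ Zonal.detP (C (n 0) * X 0 + C (n 1) * X 1 + C (n 2) * X 2) (P 8) = 0 := by
    intro β hβ
    have hM : Zonal.genM ra rb rd re rf = C β * Zonal.genL ra rb rd re rf + C (Zonal.genTau ra rb rd re rf / 3) * Zonal.normSq := by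
      rw [← hLdef, ← hβ, hM₀]; ring
    obtain ⟨n, hn, hrot⟩ := Zonal.exists_axis_of_genM_eq ra rb rd re rf hM
    refine ⟨n, hn, ?_⟩
    rw [hc₂, Zonal.detP_C_mul_right, Zonal.detP_genC_right, hM, Zonal.detP_add_right, Zonal.detP_C_mul_right,
      Zonal.detP_C_mul_right, Zonal.detP_normSq_right, hrot]
    ring
  -- (1) the second digit: `{65 P₄ + 9 c₁ A′, L}` dies on the null cone
  rw [hc₁, hc₂] at hE
  have hE' := hE
  rw [Zonal.classIdentity468_expand] at hE'
  -- cancel ONE factor `ρ`: the `P₂`-terms carry `ρ²` and join the remainder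
  obtain ⟨R₁, hR₁⟩ : ∃ R₁ : Zonal.RPoly,
      Zonal.normSq * ((C (223080 * c₂) * L ^ 3 * Zonal.detP (P 4) L - C (4324320 * c₁ * c₂) * L ^ 4 * Zonal.genW ra rb rd re rf)
        + Zonal.normSq * R₁)
      + (C 33 * Zonal.normSq ^ 2 * Zonal.detP (P 2) (C c₂ * Zonal.genC ra rb rd re rf)
        + C 18 * Zonal.normSq ^ 3 * Zonal.detP (P 2) (C c₁ * Zonal.genB ra rb rd re rf)
        + C 7 * Zonal.normSq ^ 4 * Zonal.detP (P 2) (P 4)) = 0 := ⟨_, hE'⟩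
  have hT : (C (223080 * c₂) * L ^ 3 * Zonal.detP (P 4) L - C (4324320 * c₁ * c₂) * L ^ 4 * Zonal.genW ra rb rd re rf)
      + Zonal.normSq * (R₁ + C 33 * Zonal.detP (P 2) (C c₂ * Zonal.genC ra rb rd re rf)
        + C 18 * Zonal.normSq * Zonal.detP (P 2) (C c₁ * Zonal.genB ra rb rd re rf)
        + C 7 * Zonal.normSq ^ 2 * Zonal.detP (P 2) (P 4)) = 0 := by
    have h1 : Zonal.normSq * ((C (223080 * c₂) * L ^ 3 * Zonal.detP (P 4) L
        - C (4324320 * c₁ * c₂) * L ^ 4 * Zonal.genW ra rb rd re rf)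
      + Zonal.normSq * (R₁ + C 33 * Zonal.detP (P 2) (C c₂ * Zonal.genC ra rb rd re rf)
        + C 18 * Zonal.normSq * Zonal.detP (P 2) (C c₁ * Zonal.genB ra rb rd re rf)
        + C 7 * Zonal.normSq ^ 2 * Zonal.detP (P 2) (P 4))) = 0 := by
      linear_combination hR₁
    exact (mul_eq_zero.mp h1).resolve_left hρ0
  set X : Zonal.RPoly := C (223080 * c₂) * P 4 + C (30888 * c₁ * c₂) * Zonal.genAp ra rb rd re rf with hXdef
  have hXh : X.IsHomogeneous 4 := ((hP 4 h4K).1.C_mul _).add ((Zonal.isHomogeneous_genAp ra rb rd re rf).C_mul _)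
  have hXl : Zonal.lapP X = 0 := by
    rw [hXdef, Zonal.lapP_add, Zonal.lapP_C_mul, Zonal.lapP_C_mul, (hP 4 h4K).2.1, Zonal.lapP_genAp, mul_zero, mul_zero,
      add_zero]
  have hApL : Zonal.detP (Zonal.genAp ra rb rd re rf) L = -(C 140 * L * Zonal.genW ra rb rd re rf) := by
    rw [Zonal.detP_antisymm, Zonal.detP_genL_genAp]
  have hT0 : C (223080 * c₂) * L ^ 3 * Zonal.detP (P 4) L - C (4324320 * c₁ * c₂) * L ^ 4 * Zonal.genW ra rb rd re rf
      = L ^ 3 * Zonal.detP X L := by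
    rw [hXdef, Zonal.detP_add_left, Zonal.detP_C_mul_left, Zonal.detP_C_mul_left, hApL]
    simp only [map_mul, map_ofNat]
    ring
  rw [hT0] at hT
  have hLc : Zonal.chartT (map (algebraMap ℝ ℂ) L) ≠ 0 := fun h0 =>
    hL0 (Zonal.eq_zero_of_chartT_map_eq_zero (Zonal.isHomogeneous_genL ra rb rd re rf) (Zonal.lapP_genL ra rb rd re rf) h0)
  have hXchart : Zonal.chartT (map (algebraMap ℝ ℂ) (Zonal.detP X L)) = 0 := by
    have h1 := congrArg (fun p : Zonal.RPoly => Zonal.chartT (map (algebraMap ℝ ℂ) p)) hT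
    simp only [map_add, map_mul, map_pow, Zonal.map_normSq, Zonal.chartT_add, Zonal.chartT_mul, Zonal.chartT_pow,
      Zonal.chartT_normSq, zero_mul, add_zero, map_zero, Zonal.chartT_zero] at h1
    exact (mul_eq_zero.mp h1).resolve_left (pow_ne_zero 3 hLc)
  -- the structure lemma: `X = κ A`
  obtain ⟨γ', hγ'⟩ : ∃ γ' : ℂ, map (algebraMap ℝ ℂ) X = C γ' * Zonal.genA (ra : ℂ) rb rd re rf := by
    refine Zonal.exists_eq_C_mul_genA_of_chartT_detP_genL (hXh.map _) (by rw [← Zonal.map_lapP, hXl, map_zero]) hLc0 ?_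
    rw [← hmapL, ← Zonal.map_detP]
    exact hXchart
  rw [← hmapA] at hγ'
  have hA0 : Zonal.genA ra rb rd re rf ≠ 0 := by
    intro h0
    have h1 := congrArg Zonal.chartT (congrArg (map (algebraMap ℝ ℂ)) h0)
    rw [hmapA, Zonal.chartT_genA, map_zero, Zonal.chartT_zero] at h1
    have h2 : Zonal.chartT (Zonal.genL (ra : ℂ) rb rd re rf) = 0 :=
      pow_eq_zero_iff (two_ne_zero) |>.mp ((mul_eq_zero.mp h1).resolve_left (Polynomial.C_ne_zero.mpr (by norm_num)))
    exact hLc0 (Zonal.eq_zero_of_chartT_eq_zero (Zonal.isHomogeneous_genL _ _ _ _ _) (Zonal.lapP_genL _ _ _ _ _) h2)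
  obtain ⟨κ₀, hκ₀⟩ := LoopLaw.exists_real_smul_of_map_eq_C_mul hA0 hγ'
  rw [smul_eq_C_mul] at hκ₀
  set κ : ℝ := κ₀ * (3432 * c₂)⁻¹ with hκ
  have h3432 : (3432 * c₂ : ℝ) ≠ 0 := mul_ne_zero (by norm_num) hc₂0
  have hP4eq : C 65 * P 4 = C κ * Zonal.genA ra rb rd re rf - C (9 * c₁) * Zonal.genAp ra rb rd re rf := by
    have h1 : C 65 * P 4 = C ((3432 * c₂ : ℝ)⁻¹) * X - C (9 * c₁) * Zonal.genAp ra rb rd re rf := by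
      rw [hXdef, mul_add, ← mul_assoc, ← mul_assoc, ← map_mul, ← map_mul,
        show (3432 * c₂ : ℝ)⁻¹ * (223080 * c₂) = 65 by field_simp; ring,
        show (3432 * c₂ : ℝ)⁻¹ * (30888 * c₁ * c₂) = 9 * c₁ by field_simp; ring]
      ring
    rw [h1, hκ₀, ← mul_assoc, ← map_mul, hκ, mul_comm κ₀]
  -- (2) the third digit: the closed form on the span, plus the ONE new term `2145 c₂ {P₂, C}`
  have h65 : C (975 * c₁ * c₂) * Zonal.detP (Zonal.genB ra rb rd re rf) (Zonal.genC ra rb rd re rf)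
      + C (26 * c₂) * Zonal.normSq * Zonal.detP (C κ * Zonal.genA ra rb rd re rf - C (9 * c₁) * Zonal.genAp ra rb rd re rf)
        (Zonal.genC ra rb rd re rf)
      + C (11 * c₁) * Zonal.normSq ^ 2 * Zonal.detP (C κ * Zonal.genA ra rb rd re rf - C (9 * c₁) * Zonal.genAp ra rb rd re rf)
        (Zonal.genB ra rb rd re rf)
      + Zonal.normSq ^ 2 * (C (2145 * c₂) * Zonal.detP (P 2) (Zonal.genC ra rb rd re rf)
        + Zonal.normSq * (C (1170 * c₁) * Zonal.detP (P 2) (Zonal.genB ra rb rd re rf)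
          + C 455 * Zonal.normSq * Zonal.detP (P 2) (P 4))) = 0 := by
    have h1 := congrArg (fun p : Zonal.RPoly => C 65 * p) hE
    simp only [mul_zero] at h1
    rw [← hP4eq]
    simp only [Zonal.detP_C_mul_left, Zonal.detP_C_mul_right] at h1 ⊢
    rw [← h1]
    simp only [map_mul, map_ofNat]
    ring
  rw [Zonal.classIdentity468_span] at h65
  by_cases hW0 : Zonal.genW ra rb rd re rf = 0
  · -- `W = 0`: `{L, M₀} = 0`, same-degree rigidity
    have hbr : Zonal.detP L M₀ = 0 := by
      rw [hM₀, Zonal.detP_sub_right, Zonal.detP_C_mul_right, Zonal.detP_normSq_right, mul_zero, sub_zero,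
        Zonal.detP_genL_genM, hW0, mul_zero]
    obtain ⟨β, hβ⟩ := LoopLaw.sameDegreeBracketRigidity 2 L M₀ (by norm_num)
      ⟨Zonal.isHomogeneous_genL ra rb rd re rf, Zonal.laplacian_eval_eq_zero_of_lapP (Zonal.lapP_genL ra rb rd re rf)⟩
      ⟨hM₀h, Zonal.laplacian_eval_eq_zero_of_lapP hM₀l⟩ hL0 (Zonal.bracket_eval_eq_zero_of_detP hbr)
    exact exit_of_span β (by rw [hβ, smul_eq_C_mul])
  · -- `W ≠ 0`: the digit reads `chartT L ∣ k_M c₁c₂ · chartT W · chartT M`, impossible by the coprimality of the generator charts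
    exfalso
    set kM : ℝ := -285405120 * c₁ * c₂ with hkM
    set kL : ℝ := -7138560 * c₂ * κ + 3201660 * c₁ ^ 2 with hkL
    have hkM0 : kM ≠ 0 := by rw [hkM]; exact mul_ne_zero (mul_ne_zero (by norm_num) hc₁0) hc₂0
    obtain ⟨S, hS⟩ : ∃ S : Zonal.RPoly, Zonal.normSq ^ 2 * Zonal.genW ra rb rd re rf
        * (L ^ 2 * (C kM * M + C kL * L) + Zonal.normSq * S)
        + Zonal.normSq ^ 2 * (C (2145 * c₂) * Zonal.detP (P 2) (Zonal.genC ra rb rd re rf)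
          + Zonal.normSq * (C (1170 * c₁) * Zonal.detP (P 2) (Zonal.genB ra rb rd re rf)
            + C 455 * Zonal.normSq * Zonal.detP (P 2) (P 4))) = 0 := ⟨_, h65⟩
    have hD : Zonal.genW ra rb rd re rf * (L ^ 2 * (C kM * M + C kL * L) + Zonal.normSq * S)
        + (C (2145 * c₂) * Zonal.detP (P 2) (Zonal.genC ra rb rd re rf)
          + Zonal.normSq * (C (1170 * c₁) * Zonal.detP (P 2) (Zonal.genB ra rb rd re rf)
            + C 455 * Zonal.normSq * Zonal.detP (P 2) (P 4))) = 0 := by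
      have h1 : Zonal.normSq ^ 2 * (Zonal.genW ra rb rd re rf * (L ^ 2 * (C kM * M + C kL * L) + Zonal.normSq * S)
          + (C (2145 * c₂) * Zonal.detP (P 2) (Zonal.genC ra rb rd re rf)
            + Zonal.normSq * (C (1170 * c₁) * Zonal.detP (P 2) (Zonal.genB ra rb rd re rf)
              + C 455 * Zonal.normSq * Zonal.detP (P 2) (P 4)))) = 0 := by
        linear_combination hS
      exact (mul_eq_zero.mp h1).resolve_left (pow_ne_zero 2 hρ0)
    rw [Zonal.detP_genC_right] at hD
    have h1 := congrArg (fun p : Zonal.RPoly => Zonal.chartT (map (algebraMap ℝ ℂ) p)) hD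
    simp only [map_add, map_mul, map_pow, map_sub, map_neg, Zonal.map_normSq, Zonal.chartT_add, Zonal.chartT_mul,
      Zonal.chartT_pow, Zonal.chartT_sub, Zonal.chartT_neg, Zonal.chartT_normSq, zero_mul, mul_zero, add_zero, sub_zero,
      map_zero, Zonal.chartT_zero, map_C, Zonal.chartT_C, map_ofNat] at h1
    have hn1 : Zonal.chartT (2145 : MvPolynomial (Fin 3) ℂ) = 2145 := by
      rw [← map_ofNat (C : ℂ →+* MvPolynomial (Fin 3) ℂ) 2145, Zonal.chartT_C, map_ofNat]
    have hn2 : Zonal.chartT (8580 : MvPolynomial (Fin 3) ℂ) = 8580 := by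
      rw [← map_ofNat (C : ℂ →+* MvPolynomial (Fin 3) ℂ) 8580, Zonal.chartT_C, map_ofNat]
    rw [hn1, hn2] at h1
    have h2 : Zonal.chartT (map (algebraMap ℝ ℂ) L) ^ 2
        * (Polynomial.C ((algebraMap ℝ ℂ) kM) * (Zonal.chartT (map (algebraMap ℝ ℂ) (Zonal.genW ra rb rd re rf))
            * Zonal.chartT (map (algebraMap ℝ ℂ) M))
          + Zonal.chartT (map (algebraMap ℝ ℂ) L) * (Polynomial.C ((algebraMap ℝ ℂ) kL)
              * Zonal.chartT (map (algebraMap ℝ ℂ) (Zonal.genW ra rb rd re rf))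
            + 18404100 * Polynomial.C ((algebraMap ℝ ℂ) c₂)
              * Zonal.chartT (map (algebraMap ℝ ℂ) (Zonal.detP (P 2) L)))) = 0 := by
      linear_combination h1
    have h3 := (mul_eq_zero.mp h2).resolve_left (pow_ne_zero 2 hLc)
    have hdvd : Zonal.chartT (map (algebraMap ℝ ℂ) (Zonal.genL ra rb rd re rf))
        ∣ Polynomial.C ((algebraMap ℝ ℂ) kM) * (Zonal.chartT (map (algebraMap ℝ ℂ) (Zonal.genW ra rb rd re rf))
          * Zonal.chartT (map (algebraMap ℝ ℂ) (Zonal.genM ra rb rd re rf))) :=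
      ⟨-(Polynomial.C ((algebraMap ℝ ℂ) kL) * Zonal.chartT (map (algebraMap ℝ ℂ) (Zonal.genW ra rb rd re rf))
          + 18404100 * Polynomial.C ((algebraMap ℝ ℂ) c₂) * Zonal.chartT (map (algebraMap ℝ ℂ) (Zonal.detP (P 2) L))),
        by rw [← hLdef, ← hMdef]; linear_combination h3⟩
    have hk := Zonal.eq_zero_of_chartT_genL_dvd ra rb rd re rf hW0 hdvd
    exact hkM0 (by simpa using hk)


/-! ### ★★ THM I -/

/-- ★★ **THM I — THE TOWER `{2, 4, 6, 8}` IS COAXIALLY ZONAL AT ORDER ONE.**  Let `H₂, H₄, H₆, H₈` be smooth homogeneous harmonic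
shells of degrees `2, 4, 6, 8` (`H₂`, `H₄` possibly zero) with `H₆, H₈ ≢ 0`.  If the scale-free tower of their horizon profiles is
annihilated by the order-one horizon law `𝔏₁` off the centre, then all four shells are zonal about ONE common axis `a ≠ 0`. [folklore] -/
theorem finiteTower_zonal_of_twoFourSixEight (H : ℕ → E3 → ℝ)
    (hH : ∀ l ∈ ({2, 4, 6, 8} : Finset ℕ), ContDiff ℝ (⊤ : ℕ∞) (H l))
    (hhom : ∀ l ∈ ({2, 4, 6, 8} : Finset ℕ), ∀ (c : ℝ) (y : E3), H l (c • y) = c ^ l * H l y)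
    (hharm : ∀ l ∈ ({2, 4, 6, 8} : Finset ℕ), ∀ y, Laplacian.laplacian (H l) y = 0)
    (hL1 : ∀ x : E3, x ≠ 0 → horizonL1 (fun z => ∑ l ∈ ({2, 4, 6, 8} : Finset ℕ), horizonProfile l (H l) 0 z) 0 x = 0)
    (h6 : ∃ y, H 6 y ≠ 0) (h8 : ∃ y, H 8 y ≠ 0) :
    ∃ a : E3, a ≠ 0 ∧ ∀ l ∈ ({2, 4, 6, 8} : Finset ℕ), ∀ y : E3, ⟪cross a y, gradient (H l) y⟫ = 0 := by
  classical
  have hmem : ∀ k ∈ ({2, 4, 6, 8} : Finset ℕ), k = 2 ∨ k = 4 ∨ k = 6 ∨ k = 8 := fun k hk => by simpa using hk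
  have hK1 : ∀ k ∈ ({2, 4, 6, 8} : Finset ℕ), 1 ≤ k := by
    intro k hk; rcases hmem k hk with rfl | rfl | rfl | rfl <;> norm_num
  have hmax : ∀ k ∈ ({2, 4, 6, 8} : Finset ℕ), k ≤ 8 := by
    intro k hk; rcases hmem k hk with rfl | rfl | rfl | rfl <;> omega
  obtain ⟨P, hP⟩ := finiteTower_exists_polys {2, 4, 6, 8} H hH hhom hharm
  have hne : ∀ {l}, l ∈ ({2, 4, 6, 8} : Finset ℕ) → (∃ y, H l y ≠ 0) → P l ≠ 0 := by
    intro l hl ⟨y, hy⟩ h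
    apply hy
    rw [(hP l hl).2.2 y, h]
    simp [Zonal.evalE]
  have h6K : (6 : ℕ) ∈ ({2, 4, 6, 8} : Finset ℕ) := by simp
  have h8K : (8 : ℕ) ∈ ({2, 4, 6, 8} : Finset ℕ) := by simp
  obtain ⟨n, hn, htop⟩ := finiteTower_exists_axis_of_twoFourSixEight H hH hhom hharm hL1 P hP (hne h6K h6) (hne h8K h8)
  have hall := finiteTower_detP_lin_eq_zero_of_top {2, 4, 6, 8} H hK1 hH hhom hharm hL1 P hP h8K hmax (hne h8K h8) hn htop
  have hna : (WithLp.toLp 2 n : E3) ≠ 0 := by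
    intro h
    apply hn
    funext i
    have := congrArg (fun v : E3 => v i) h
    simpa using this
  refine ⟨WithLp.toLp 2 n, hna, fun l hl y => ?_⟩
  have h := hall l hl
  rw [Zonal.detP_lin_eq_zero_iff] at h
  have := h y
  rwa [← show H l = Zonal.evalE (P l) from funext (hP l hl).2.2] at this

/-- THM I with the ZONAL FUNCTIONAL FORMS as conclusion. [folklore] -/
theorem finiteTower_zonalForm_of_twoFourSixEight (H : ℕ → E3 → ℝ)
    (hH : ∀ l ∈ ({2, 4, 6, 8} : Finset ℕ), ContDiff ℝ (⊤ : ℕ∞) (H l))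
    (hhom : ∀ l ∈ ({2, 4, 6, 8} : Finset ℕ), ∀ (c : ℝ) (y : E3), H l (c • y) = c ^ l * H l y)
    (hharm : ∀ l ∈ ({2, 4, 6, 8} : Finset ℕ), ∀ y, Laplacian.laplacian (H l) y = 0)
    (hL1 : ∀ x : E3, x ≠ 0 → horizonL1 (fun z => ∑ l ∈ ({2, 4, 6, 8} : Finset ℕ), horizonProfile l (H l) 0 z) 0 x = 0)
    (h6 : ∃ y, H 6 y ≠ 0) (h8 : ∃ y, H 8 y ≠ 0) :
    ∃ a : E3, a ≠ 0 ∧ ∀ l ∈ ({2, 4, 6, 8} : Finset ℕ), ∃ g : ℝ → ℝ, ∀ y : E3, y ≠ 0 → H l y = ‖y‖ ^ l * g (⟪a, y⟫ / ‖y‖) := by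
  obtain ⟨a, ha, hall⟩ := finiteTower_zonal_of_twoFourSixEight H hH hhom hharm hL1 h6 h8
  exact ⟨a, ha, fun l hl => exists_zonalForm_of_inner_cross_gradient_eq_zero (l := l) ha ((hH l hl).differentiable (by simp))
    (fun c y _ => hhom l hl c y) (hall l hl)⟩

end Summit.NavierStokesRegularity.NavierStokesRegularity.Theorems.PoloidalLiouville.HorizonTower

end
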